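/-
Copyright: the b2b-balaban cell (near-miss cell 7), T⁴-continuum fan-out, lineage t4-ne7b-p1 (node U5c COUNT member).
Released under the licence of the surrounding project.
-/
import Summits.QuantumFields.BalabanUV.T4Continuum.Support.CrowdingRoots

/-!
# Zone skeleton: the multiplicity of positioned genealogies in ZONE form (one factor per merger)

Summits-side support leaf of the T⁴-continuum cell (rung (B)+1 on a FINITE torus only; NOT infinite volume, NOT the
mass gap, NOT the Clay statement; NOT a proof of the spine estimate NE7b).  Lineage `t4-ne7b-p1`, node U5c, wall (GM)
of the cell's gap census, located item G-ne7bp1g18-2 part (I): the ZONE-TARGET re-assembly.  [folklore] finite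
combinatorics, generic in the event type `ε` and the cell type `γ`; nothing is quoted from print and nothing printed
is asserted; no `[cite:]` tag.

WHY.  The pair-form skeleton (`Support/PlacementSkeleton.lean`) asks at a merger that SOME piece of the younger
structure touch SOME piece of the older one and pays a SUM OVER PAIRS per merger — an artefact that grows factorially
along same-step batches.  In ZONE form a merger asks only that the two structures' ZONES touch; abstractly: the ROOT
CELLS of the two partners (read at their root scales) are `near` at the merger step within the radius
`ext t X + ext t Y` (the extents of the two zones — DISPLAYED data `ext : ℕ → Gen ε → ℝ`, nonnegative).  The one-merger
input is a count of root positions: for a fixed cell `x` of scale `sx`, a step `t` and a radius `r ≥ 0`, the cells `y`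
of scale `sy` with `near x sx y sy t r` number at most `NZ r t sy` (DISPLAYED binder; in the index model `(2r+1)^d`
coarse cells times the blocking fibre `Λ^{t+1−sy}`, cf. `Support/PartnerPlacement.lean`).

WHAT THIS FILE PROVES.  §1 `AdmZ` (zone-form admissibility, structural), locality `admZ_congr`.  §2 `zoneW` (one factor
`NZ (ext t X + ext t Y) t (max rootStep)` per merger — the free root is the YOUNGER one) and `card_admZSet_le`: for a
separated genealogy the admissible placements with the root piece at a given cell number at most `zoneW G` (generic
link count `PlacementSkeleton.card_link_le`).  §3 exponent bookkeeping: with `NZ r t s ≤ M r · Λ^{t+1−s}` on `r ≥ 0`,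
`zoneW G ≤ Λ^{partnerAges st G} · combZ M ext st G` — the exponent of the chain binder ON THE NOSE (same truncated
subtraction as `partnerAges`; no order hypothesis), `combZ` = one factor `M (ext t X + ext t Y)` per merger, and the
assembled `card_admZSet_root_le`.  The DRIVERS (recent weighted formation activity bounding the extents through a
displayed contraction law, the polynomial touch count, and the final shape
`Λ^{partnerAges} · (M₀ (C₀+1)^d)^{#mergers} · ∏_Z q_Z^d` whose last factor the weighted crowding theorem pays) are the
sequel `Support/ZoneDrivers.lean`.

WHAT THIS FILE DOES NOT DO ∕ LOCATED.  It does not instantiate `near`, `NZ`, `ext`, `wt`, `C₀`, `M₀` (index model +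
the reading (ID), G-ne7bp1g9-1: which regions, which blocking, which collars; the contraction law `ext ↦ ext∕L + c` is
geometry of the reading); renewals impose nothing and weigh nothing here (under the dictionary an adjacent NEW region
is a birth merged in, `merge X (born b′ x) e`; if the reading lets a renewal enlarge a zone, a weight on renewals and
a renewal-side payer are owed — located, not asserted); finite `ε`, `γ` for the counting theorems.

HONEST DEPENDENCY (cell): continuum YM on T⁴ ⇐ BetaPertH ∧ nine spine estimates (0/9 proved); BetaPertH ⇐ (D1) ∧ (D4)
∧ CAP+tail.  This file changes none of it.
-/

open Finset
open Literature.MathematicalPhysics.QuantumFieldTheory.Balaban1983to89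
open T4PersistenceDictionary T4PartnerMultiplicity
open Summit.QuantumFields.BalabanUV.T4Continuum.PlacementSkeleton
open Summit.QuantumFields.BalabanUV.T4Continuum.Crowding

namespace Summit.QuantumFields.BalabanUV.T4Continuum.ZoneSkeleton

noncomputable section

variable {ε : Type*} [DecidableEq ε] {γ : Type*}

/-! ## §1 Zone-form admissibility -/

/-- ZONE-FORM ADMISSIBILITY of a placement `P : ε → γ` (birth cells of the pieces): at every merger the root cells of
the two partners, read at their root scales, are `near` at the merger step within the radius `ext t X + ext t Y`;
births and renewals impose nothing. [folklore] -/
def AdmZ (near : γ → ℕ → γ → ℕ → ℕ → ℝ → Prop) (ext : ℕ → Gen ε → ℝ) (st : ε → ℕ) : Gen ε → (ε → γ) → Prop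
  | Gen.born _ _, _ => True
  | Gen.renew G _ _, P => AdmZ near ext st G P
  | Gen.merge X Y e, P => AdmZ near ext st X P ∧ AdmZ near ext st Y P ∧
      near (P X.root) X.rootStep (P Y.root) Y.rootStep (st e) (ext (st e) X + ext (st e) Y)

omit [DecidableEq ε] in
/-- LOCALITY: zone admissibility only reads the placement on the births. [folklore] -/
theorem admZ_congr (near : γ → ℕ → γ → ℕ → ℕ → ℝ → Prop) (ext : ℕ → Gen ε → ℝ) (st : ε → ℕ)
    [DecidableEq ε] : ∀ (G : Gen ε) {P P' : ε → γ}, (∀ b ∈ births G, P b = P' b) →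
      (AdmZ near ext st G P ↔ AdmZ near ext st G P')
  | Gen.born _ _, _, _, _ => Iff.rfl
  | Gen.renew G _ _, _, _, h => admZ_congr near ext st G h
  | Gen.merge X Y e, P, P', h => by
      have hX : ∀ b ∈ births X, P b = P' b := fun b hb => h b (mem_union.2 (Or.inl hb))
      have hY : ∀ b ∈ births Y, P b = P' b := fun b hb => h b (mem_union.2 (Or.inr hb))
      simp only [AdmZ]
      rw [admZ_congr near ext st X hX, admZ_congr near ext st Y hY, hX _ (root_mem_births X),
        hY _ (root_mem_births Y)]

/-! ## §2 The zone weight and the count -/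

omit [DecidableEq ε] in
/-- THE ZONE WEIGHT: one factor per merger — root positions of the YOUNGER partner (scale `max rootStep`) near the
older partner's root within the summed extents. [folklore] -/
def zoneW (NZ : ℝ → ℕ → ℕ → ℕ) (ext : ℕ → Gen ε → ℝ) (st : ε → ℕ) : Gen ε → ℕ
  | Gen.born _ _ => 1
  | Gen.renew G _ _ => zoneW NZ ext st G
  | Gen.merge X Y e => zoneW NZ ext st X * zoneW NZ ext st Y *
      NZ (ext (st e) X + ext (st e) Y) (st e) (max X.rootStep Y.rootStep)

omit [DecidableEq ε] in
/-- the root of a merger when the first partner is (weakly) older [folklore] -/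
theorem root_merge_of_le {X Y : Gen ε} (e : ε) (h : X.rootStep ≤ Y.rootStep) : (Gen.merge X Y e).root = X.root := by
  show (if X.rootStep ≤ Y.rootStep then X.root else Y.root) = X.root
  rw [if_pos h]

omit [DecidableEq ε] in
/-- the root of a merger when the second partner is strictly older [folklore] -/
theorem root_merge_of_not_le {X Y : Gen ε} (e : ε) (h : ¬ X.rootStep ≤ Y.rootStep) :
    (Gen.merge X Y e).root = Y.root := by
  show (if X.rootStep ≤ Y.rootStep then X.root else Y.root) = Y.root
  rw [if_neg h]

section Count

variable [Fintype ε] [Fintype γ] [DecidableEq γ]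

open scoped Classical

/-- The zone-admissible placements of `G` with piece `p` at cell `c` and the junk value `c₀` off the births.
[folklore] -/
def admZSet (near : γ → ℕ → γ → ℕ → ℕ → ℝ → Prop) (ext : ℕ → Gen ε → ℝ) (st : ε → ℕ) (G : Gen ε) (p : ε)
    (c c₀ : γ) : Finset (ε → γ) :=
  univ.filter fun P => AdmZ near ext st G P ∧ P p = c ∧ ∀ e, e ∉ births G → P e = c₀

/-- **ZONE-FORM MULTIPLICITY ≤ THE ZONE WEIGHT.**  For a separated genealogy rooted at its root piece placed at `c`,
the zone-admissible placements number at most `zoneW NZ ext st G`, given the two one-merger ROOT-POSITION bounds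
`#{y : near x sx y sy t r} ≤ NZ r t sy` (every `x`) and `#{x : near x sx y sy t r} ≤ NZ r t sx` (every `y`).
[folklore] -/
theorem card_admZSet_le (near : γ → ℕ → γ → ℕ → ℕ → ℝ → Prop) (ext : ℕ → Gen ε → ℝ) (st : ε → ℕ)
    (NZ : ℝ → ℕ → ℕ → ℕ)
    (hN1 : ∀ (x : γ) (sx sy t : ℕ) (r : ℝ), (univ.filter fun y : γ => near x sx y sy t r).card ≤ NZ r t sy)
    (hN2 : ∀ (y : γ) (sx sy t : ℕ) (r : ℝ), (univ.filter fun x : γ => near x sx y sy t r).card ≤ NZ r t sx) :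
    ∀ (G : Gen ε), Separated G → ∀ c c₀ : γ, (admZSet near ext st G G.root c c₀).card ≤ zoneW NZ ext st G
  | Gen.born b j, _, c, c₀ => by
      show (admZSet near ext st (Gen.born b j) b c c₀).card ≤ 1
      refine Finset.card_le_one.2 fun P hP P' hP' => ?_
      simp only [admZSet, AdmZ, births_born, mem_singleton, true_and, mem_filter, mem_univ] at hP hP'
      funext x
      by_cases hx : x = b
      · rw [hx, hP.1, hP'.1]
      · rw [hP.2 x hx, hP'.2 x hx]
  | Gen.renew G e h, hS, c, c₀ => card_admZSet_le near ext st NZ hN1 hN2 G hS c c₀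
  | Gen.merge X Y e, hS, c, c₀ => by
      obtain ⟨hSX, hSY, hd⟩ := hS
      have ihX := fun x => card_admZSet_le near ext st NZ hN1 hN2 X hSX x c₀
      have ihY := fun x => card_admZSet_le near ext st NZ hN1 hN2 Y hSY x c₀
      have hlocX := fun P P' hPP => admZ_congr near ext st X (P := P) (P' := P') hPP
      have hlocY := fun P P' hPP => admZ_congr near ext st Y (P := P) (P' := P') hPP
      by_cases hle : X.rootStep ≤ Y.rootStep
      · -- the merger's root is `X.root`; the free root is `Y.root`, of scale `Y.rootStep = max`
        rw [root_merge_of_le e hle, zoneW, max_eq_right hle]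
        have hcover : admZSet near ext st (Gen.merge X Y e) X.root c c₀ ⊆
            univ.filter fun P : ε → γ => AdmZ near ext st X P ∧ AdmZ near ext st Y P ∧
              (fun yv xu => near xu X.rootStep yv Y.rootStep (st e) (ext (st e) X + ext (st e) Y))
                (P Y.root) (P X.root) ∧ P X.root = c ∧ ∀ x, x ∉ births X ∪ births Y → P x = c₀ := by
          intro P hP
          simp only [admZSet, AdmZ, births_merge, mem_filter, mem_univ, true_and] at hP ⊢
          obtain ⟨⟨h1, h2, h3⟩, h4, h5⟩ := hP
          exact ⟨h1, h2, h3, h4, h5⟩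
        calc (admZSet near ext st (Gen.merge X Y e) X.root c c₀).card
            ≤ _ := card_le_card hcover
          _ ≤ zoneW NZ ext st X * (NZ (ext (st e) X + ext (st e) Y) (st e) Y.rootStep * zoneW NZ ext st Y) :=
              card_link_le (births X) (births Y) hd _ _ hlocX hlocY
                (fun yv xu => near xu X.rootStep yv Y.rootStep (st e) (ext (st e) X + ext (st e) Y))
                (root_mem_births X) (root_mem_births X) (root_mem_births Y) c c₀ (ihX c)
                (fun xu => hN1 xu X.rootStep Y.rootStep (st e) _) ihY
          _ = zoneW NZ ext st X * zoneW NZ ext st Y * NZ (ext (st e) X + ext (st e) Y) (st e) Y.rootStep := by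
              ring
      · -- the merger's root is `Y.root`; the free root is `X.root`, of scale `X.rootStep = max`
        rw [root_merge_of_not_le e hle, zoneW, max_eq_left (le_of_lt (not_le.1 hle))]
        have hcover : admZSet near ext st (Gen.merge X Y e) Y.root c c₀ ⊆
            univ.filter fun P : ε → γ => AdmZ near ext st Y P ∧ AdmZ near ext st X P ∧
              (fun xv yu => near xv X.rootStep yu Y.rootStep (st e) (ext (st e) X + ext (st e) Y))
                (P X.root) (P Y.root) ∧ P Y.root = c ∧ ∀ x, x ∉ births Y ∪ births X → P x = c₀ := by
          intro P hP
          simp only [admZSet, AdmZ, births_merge, mem_filter, mem_univ, true_and] at hP ⊢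
          obtain ⟨⟨h1, h2, h3⟩, h4, h5⟩ := hP
          exact ⟨h2, h1, h3, h4, fun x hx => h5 x (by rwa [union_comm])⟩
        calc (admZSet near ext st (Gen.merge X Y e) Y.root c c₀).card
            ≤ _ := card_le_card hcover
          _ ≤ zoneW NZ ext st Y * (NZ (ext (st e) X + ext (st e) Y) (st e) X.rootStep * zoneW NZ ext st X) :=
              card_link_le (births Y) (births X) hd.symm _ _ hlocY hlocX
                (fun xv yu => near xv X.rootStep yu Y.rootStep (st e) (ext (st e) X + ext (st e) Y))
                (root_mem_births Y) (root_mem_births Y) (root_mem_births X) c c₀ (ihY c)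
                (fun yu => hN2 yu X.rootStep Y.rootStep (st e) _) ihX
          _ = zoneW NZ ext st X * zoneW NZ ext st Y * NZ (ext (st e) X + ext (st e) Y) (st e) X.rootStep := by
              ring

end Count

/-! ## §3 Exponent bookkeeping: the fibre factors multiply to `Λ^{partnerAges}` on the nose -/

omit [DecidableEq ε] in
/-- THE ZONE COMBINATORIAL FACTOR: one factor `M (ext t X + ext t Y)` per merger (the zone weight with the blocking
fibre `Λ^{t+1−s}` stripped). [folklore] -/
def combZ (M : ℝ → ℝ) (ext : ℕ → Gen ε → ℝ) (st : ε → ℕ) : Gen ε → ℝ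
  | Gen.born _ _ => 1
  | Gen.renew G _ _ => combZ M ext st G
  | Gen.merge X Y e => combZ M ext st X * combZ M ext st Y * M (ext (st e) X + ext (st e) Y)

omit [DecidableEq ε] in
/-- `combZ ≥ 0` for `M ≥ 0` [folklore] -/
theorem combZ_nonneg (M : ℝ → ℝ) (hM : ∀ r, 0 ≤ M r) (ext : ℕ → Gen ε → ℝ) (st : ε → ℕ) :
    ∀ G : Gen ε, 0 ≤ combZ M ext st G
  | Gen.born _ _ => zero_le_one
  | Gen.renew G _ _ => combZ_nonneg M hM ext st G
  | Gen.merge X Y _ => mul_nonneg (mul_nonneg (combZ_nonneg M hM ext st X) (combZ_nonneg M hM ext st Y)) (hM _)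

omit [DecidableEq ε] in
/-- **EXPONENT ON THE NOSE.**  If on nonnegative radii the root-position bound carries the blocking fibre of the free
(younger) root, `NZ r t s ≤ M r · Λ^{t+1−s}` (truncated subtraction), and extents are nonnegative, then
`zoneW G ≤ Λ^{partnerAges st G} · combZ M ext st G` — the same truncated ages as `partnerAges`; NO order hypothesis.
[folklore] -/
theorem zoneW_le (NZ : ℝ → ℕ → ℕ → ℕ) (M : ℝ → ℝ) (hM : ∀ r, 0 ≤ M r) (ext : ℕ → Gen ε → ℝ)
    (hext0 : ∀ t X, 0 ≤ ext t X) (st : ε → ℕ) {Λ : ℝ} (hΛ : 0 ≤ Λ)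
    (hNZ : ∀ r t s, 0 ≤ r → (NZ r t s : ℝ) ≤ M r * Λ ^ (t + 1 - s)) :
    ∀ G : Gen ε, (zoneW NZ ext st G : ℝ) ≤ Λ ^ partnerAges st G * combZ M ext st G
  | Gen.born _ _ => by simp [zoneW, combZ]
  | Gen.renew G _ _ => by simpa [zoneW, combZ] using zoneW_le NZ M hM ext hext0 st hΛ hNZ G
  | Gen.merge X Y e => by
      have ihX := zoneW_le NZ M hM ext hext0 st hΛ hNZ X
      have ihY := zoneW_le NZ M hM ext hext0 st hΛ hNZ Y
      have h3 := hNZ (ext (st e) X + ext (st e) Y) (st e) (max X.rootStep Y.rootStep)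
        (add_nonneg (hext0 _ _) (hext0 _ _))
      have cX := combZ_nonneg M hM ext st X
      have cY := combZ_nonneg M hM ext st Y
      rw [zoneW, partnerAges_merge, combZ]
      push_cast
      calc (zoneW NZ ext st X : ℝ) * (zoneW NZ ext st Y : ℝ) *
            (NZ (ext (st e) X + ext (st e) Y) (st e) (max X.rootStep Y.rootStep) : ℝ)
          ≤ (Λ ^ partnerAges st X * combZ M ext st X) * (Λ ^ partnerAges st Y * combZ M ext st Y) *
              (M (ext (st e) X + ext (st e) Y) * Λ ^ (st e + 1 - max X.rootStep Y.rootStep)) :=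
            mul_le_mul (mul_le_mul ihX ihY (Nat.cast_nonneg _) (mul_nonneg (pow_nonneg hΛ _) cX)) h3
              (Nat.cast_nonneg _) (mul_nonneg (mul_nonneg (pow_nonneg hΛ _) cX) (mul_nonneg (pow_nonneg hΛ _) cY))
        _ = Λ ^ (partnerAges st X + partnerAges st Y + (st e + 1 - max X.rootStep Y.rootStep)) *
              (combZ M ext st X * combZ M ext st Y * M (ext (st e) X + ext (st e) Y)) := by
            rw [pow_add, pow_add]; ring

section Root

variable [Fintype ε] [Fintype γ] [DecidableEq γ]

open scoped Classical

/-- **THE ASSEMBLED ZONE-FORM MULTIPLICITY BOUND**: admissible placements of a separated genealogy with its root piece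
at `c` number at most `Λ^{partnerAges st G} · combZ M ext st G`. [folklore] -/
theorem card_admZSet_root_le (near : γ → ℕ → γ → ℕ → ℕ → ℝ → Prop) (ext : ℕ → Gen ε → ℝ)
    (hext0 : ∀ t X, 0 ≤ ext t X) (st : ε → ℕ) (NZ : ℝ → ℕ → ℕ → ℕ) (M : ℝ → ℝ) (hM : ∀ r, 0 ≤ M r)
    {Λ : ℝ} (hΛ : 0 ≤ Λ)
    (hN1 : ∀ (x : γ) (sx sy t : ℕ) (r : ℝ), (univ.filter fun y : γ => near x sx y sy t r).card ≤ NZ r t sy)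
    (hN2 : ∀ (y : γ) (sx sy t : ℕ) (r : ℝ), (univ.filter fun x : γ => near x sx y sy t r).card ≤ NZ r t sx)
    (hNZ : ∀ r t s, 0 ≤ r → (NZ r t s : ℝ) ≤ M r * Λ ^ (t + 1 - s))
    (G : Gen ε) (hsep : Separated G) (c c₀ : γ) :
    ((admZSet near ext st G G.root c c₀).card : ℝ) ≤ Λ ^ partnerAges st G * combZ M ext st G :=
  le_trans (by exact_mod_cast card_admZSet_le near ext st NZ hN1 hN2 G hsep c c₀)
    (zoneW_le NZ M hM ext hext0 st hΛ hNZ G)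

end Root

end

end Summit.QuantumFields.BalabanUV.T4Continuum.ZoneSkeleton
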